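import Summits.BirchSwinnertonDyer.Rank1Residual.Partition.MainConjecturesAnticyclotomicClass
import Summits.BirchSwinnertonDyer.Rank1Residual.X9.BigImageWitnesses
import Summits.BirchSwinnertonDyer.Rank1Residual.X11b.BDPRouteSurj
import Literature.NumberTheory.EllipticCurves.BurungaleCastellaSkinner2025.CyclotomicMainTheoremIntegral
import HarnessLib

/-!
# The good-ordinary IRREDUCIBLE column (row C2 = Burungale–Castella–Skinner 2025; the ordinary part
# of row C3; class X9 as the residue) at MAIN-CONJECTURE level

HONEST FRAMING (cell `b2b-bsdres`, run/shared/lean/b2b/bsd-rank1-residual/; verbatim): the goal is to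
DELETE the COMBINATION-SHAPED residual classes for ALL analytic-rank `≤ 1` curves over `ℚ` — "full BSD
formula for every rank `≤ 1` curve in class `C`" assembled STRICTLY from published theorems — so
that the rank-`≤ 1` remainder becomes exactly the CONSTRUCTION-SHAPED classes, which are TYPED
(missing-input `Prop`s), NOT attempted; this is not "finishing BSD". Theorems only; NO named fact and
NO definition; every published theorem enters as one of the tree's existing named Literature facts
BY NAME; every unproved statement enters as an EXPLICIT binder; nothing about any particular curve
is asserted; no label changes. Unit `b2b-bsdres-lit-glue` (GLUE seat), gen 2 — sequel to
`Partition/MainConjectures.lean` (§3 row C2: "the tree types only the rational part (a) … so the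
main-conjecture input enters here as the typed predicate `MazurMainConjecture W p`"), written after
typing Burungale–Castella–Skinner's INTEGRAL cyclotomic main conjecture Thm. 1.1.2 (b)
(`BurungaleCastellaSkinner2025.thm112b_charIdeal_eq_padicLFunction_integral`, same seat, same night).

## What this file records

| row / locus (good ordinary `p > 3`, `E[p]` irreducible) | main-conjecture input (typed, PUBLISHED) | control / leading-term inputs (named facts) | theorem here |
|---|---|---|---|
| the typed MC itself on {(irr), (im)} | BCS 2025 Thm. 1.1.2 (b) IS `MazurMainConjecture W p` there | — | `mazurMainConjecture_of_bcsThm112b`, `RowC2.mazurMainConjecture_of_bcsThm112b`, `…_of_surj` |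
| the column's residue | granted BCS (b): "Mazur's MC at EVERY good ordinary irreducible `p > 3`" ⟺ "… at the NON-SURJECTIVE ones" (= the image locus of class X9, CM included) | (irr) ∧ (im) ⟺ (irr) ∧ surj at `p ≥ 5` (`X9.bigIm_iff_surj_of_irr`) | `forall_mazurMainConjecture_irreducible_iff_nonSurj` |
| **C2 ∩ {r = 0}** (BCS Cor. 1.3.1) | Thm. 1.1.2 (b) | Greenberg 1999 Thm. 4.1; modularity; GZK | **`RowC2.bsdp_rankZero_of_bcsThm112b`** — NO `@[conjecture]` binder left |
| **C2 ∩ {r = 1}**, `p ∤ ∏c_ℓ`, AT A HEEGNER DATUM — the PRINTED route of Cor. 1.3.1 ("Theorem 1.2.4, the `p`-adic Waldspurger formula [BDP13] …, the anticyclotomic control theorem [JSW17, Thm. 3.3.1], and the `r = 0` result for the `K`-quadratic twist of `E`", p. 4) | STEP L `X11b.IndexLowerBoundAt W p K P` (TYPED binder `hL`) + the twist's typed `MazurMainConjecture Wd p` = Thm. 1.1.2 (b) for `E^K` | Gross–Zagier; Kolyvagin (×2); Greenberg Thm. 4.1; modularity (×2); GZK | `X11b.bsdp_rankOne_of_indexLowerBoundAt_of_twist_mazurMainConjecture`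 (any odd `p`, twist MC typed), `X11b.bsdp_rankOne_of_indexLowerBoundAt_of_goodOrd_twist_of_bcs` (datum level; the CLASS level — field choice over EXACTLY the data (disc), (Heeg), (spl) of BCS Thm. 1.2.4 and the transports — is the companion file `MainConjecturesIrreducibleClass.lean`) |

On STEP L at a GOOD prime (cell finding C186, lit g36; this seat's gen-0 CORRECTION): JSW 2017 print
(eq:shalowerK-1) only for their `K'` with a NON-split `q ∣ N` and the Shimura-curve point
`z^{N⁺,N⁻}`; the tree's `IndexLowerBoundAt` reads the inequality for `K` with EVERY `ℓ ∣ N` split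
(classical `X₀(N)` Heegner point). For such `K` the printed main-conjecture-level source at a good
ordinary `p > 3` is Burungale–Castella–Skinner 2025: Thm. 1.2.2 (Perrin-Riou's Heegner point main
conjecture) and Thm. 1.2.4 (the BDP / Iwasawa–Greenberg main conjecture `ch(X_Gr(E/K_∞⁻)) =
(L_p^{BDP}(E/K))`), both for `K` with (disc) `D_K` odd `≠ −3`, (Heeg) every `ℓ ∣ N` split, (spl) `p`
split, under (irr_ℚ) in `Λ ⊗ ℚ_p` and under (sur) integrally, `p > 3` — NO ramification hypothesis, NO
conductor hypothesis, N⁻ = 1. The binder `hL` below is therefore quantified over EXACTLY these data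
(`Odd (discr K)`, `discr K < −4`, `SatisfiesHeegnerHypothesis N K`, `SatisfiesHeegnerHypothesis p K`),
so that it reads "BCS Thm. 1.2.4 (PUBLISHED, typed nowhere: no Literature object for `X_Gr(E/K_∞⁻)` /
`L_p^{BDP}` yet — lit-cgls sized ask S1) + BDP formula + JSW Thm. 3.3.1 control ⟹ index lower bound"
— the printed proof route of Cor. 1.3.1 (`r = 1`). The inequality itself is not displayed by BCS, so
`hL` stays a TYPED input (no Literature fact is, or could faithfully be, cited for it); what this file
proves is that NOTHING ELSE un-typed enters row C2.

References: Burungale–Castella–Skinner, IMRN 2025 rnaf082 = arXiv:2405.00270v2, Thm. 1.1.2, 1.2.2,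
1.2.4, Cor. 1.3.1 and its proof, Rem. 1.1.3, Lemma 5.2.3 [BurungaleCastellaSkinner2025]; Greenberg LNM
1716 Thm. 4.1 [GreenbergLNM1716]; Jetchev–Skinner–Wan 2017 §7.4.1, Thm. 3.3.1 [JetchevSkinnerWan2017];
Gross–Zagier 1986 [GrossZagier1986]; Kolyvagin 1990 / McCallum 1991 [McCallumLMS1991]; Hoffstein–Luo 1997
[HoffsteinLuo1997]; Mazur 1978 Cor. 4.1 [Mazur1978]; Serre 1972 Prop. 15 / IV-23 [Serre1972];
Silverman AEC X.5 Cor. 5.4 [SilvermanAEC2009]; Miller 2011 Def. 1.1 [Miller2011LMS]; RESIDUAL-CASES.md §a.1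
C2/C3, §a.2 X9; HOME/b2b-bsdres-lit-glue/GLUE.md §4 A1/A2, CITED-FACTS.md C186.
-/

set_option autoImplicit false

noncomputable section

open scoped Classical MatrixGroups ModularForm

open CongruenceSubgroup WeierstrassCurve NumberField Literature.NumberTheory.EllipticCurves
  Literature.NumberTheory.EllipticCurves.ModularForms
  Literature.NumberTheory.EllipticCurves.Rank1Residual
  Literature.NumberTheory.EllipticCurves.BurungaleCastellaSkinner2025
  Literature.NumberTheory.EllipticCurves.KrizLi2019
  Summit.BirchSwinnertonDyer.BirchSwinnertonDyer.Theorems.Rank1ResidualX1Defs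

namespace Summit.BirchSwinnertonDyer.Rank1Residual

section Curve

variable {W : WeierstrassCurve ℚ} [W.IsElliptic] [W.IsGloballyMinimal] {p : ℕ} [Fact p.Prime]

/-! ### §1. Adapter: BCS 2025 Thm. 1.1.2 (b) (typed) IS the typed main conjecture on its locus -/

/-- **Burungale–Castella–Skinner 2025 Thm. 1.1.2 (b) ⇒ `MazurMainConjecture W p`** at a good ordinary
`p > 3` with (irr_ℚ) and (im): the named fact `thm112b_charIdeal_eq_padicLFunction_integral` is,
binder for binder, the cell's `@[conjecture]` predicate — on this locus the typed input of the
rank-`0` skeleton is a THEOREM of the published record. [cite: BurungaleCastellaSkinner2025, Thm. 1.1.2 (b) (p. 2)] -/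
theorem mazurMainConjecture_of_bcsThm112b (hBCS : thm112b_charIdeal_eq_padicLFunction_integral)
    (hp : 3 < p) (hord : GoodOrd W p) (hirr : Irr W p) (him : BigIm W p) :
    MazurMainConjecture W p :=
  hBCS W p hp hord hirr him

/-- Row C2's predicate (`¬cm ∧ 3 < p ∧ GoodOrd ∧ Irr ∧ BigIm`) feeds the adapter (the non-CM clause is
not used). [cite: BurungaleCastellaSkinner2025, Thm. 1.1.2 (b), Cor. 1.3.1] -/
theorem RowC2.mazurMainConjecture_of_bcsThm112b (hBCS : thm112b_charIdeal_eq_padicLFunction_integral)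
    (h : RowC2 W p) : MazurMainConjecture W p :=
  Summit.BirchSwinnertonDyer.Rank1Residual.mazurMainConjecture_of_bcsThm112b hBCS h.2.1 h.2.2.1
    h.2.2.2.1 h.2.2.2.2

/-- **At `p ≥ 5`, surjectivity of `ρ̄_{E,p}` suffices**: surj ⇒ (irr) (`irr_of_surj`) and surj ⇒ (im)
(Serre IV-23 lifting + `(1 1; 0 1) ∈ SL₂(ℤ_p)`: the X9 seat's `X9.bigIm_of_surj`), so BCS Thm. 1.1.2 (b)
gives the typed main conjecture at every good ordinary surjective `p ≥ 5` — no (ram) prime needed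
(contrast `mazurMainConjecture_of_skinnerUrban`). [cite: BurungaleCastellaSkinner2025, Thm. 1.1.2 (b), Rem. 1.1.3 (i)]
[cite: Serre1972, IV §3.4 Lemma 3] -/
theorem mazurMainConjecture_of_bcsThm112b_of_surj
    (hBCS : thm112b_charIdeal_eq_padicLFunction_integral) (hp5 : 5 ≤ p) (hord : GoodOrd W p)
    (hsurj : Surj W p) : MazurMainConjecture W p :=
  mazurMainConjecture_of_bcsThm112b hBCS (by omega) hord (irr_of_surj W p hsurj)
    (X9.bigIm_of_surj W p hp5 hsurj)

/-- **On Skinner–Urban's good locus at `p ≥ 5` BCS (b) applies too**: (irr) + (ram) ⇒ (im) at every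
prime (`X9.bigIm_of_irr_of_ram`: the inertia transvection at the ramified multiplicative prime). So for
`p ≥ 5` the integral cyclotomic main conjecture of row C1's good branch is ALSO an instance of the BCS
fact ("Our main result … removes the hypothesis (mult)", p. 2). [cite: BurungaleCastellaSkinner2025, Thm. 1.1.2 (b) and p. 2 L13]
[cite: SkinnerUrban2014, Thm. 3.6.9] -/
theorem mazurMainConjecture_of_bcsThm112b_of_ram
    (hBCS : thm112b_charIdeal_eq_padicLFunction_integral) (hp5 : 5 ≤ p) (hord : GoodOrd W p)
    (hirr : Irr W p) (hram : Ram W p) : MazurMainConjecture W p :=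
  mazurMainConjecture_of_bcsThm112b hBCS (by omega) hord hirr (X9.bigIm_of_irr_of_ram W p hirr hram)

end Curve

/-- **The irreducible good-ordinary column of the main-conjecture grid is partitioned, no cell
unaccounted**: granted BCS 2025 Thm. 1.1.2 (b), "Mazur's (integral, Néron-normalised) main conjecture
holds for EVERY `E/ℚ` at EVERY good ordinary `p > 3` with `E[p]` irreducible" is EQUIVALENT to the
same statement on the NON-SURJECTIVE pairs only — the image locus `irr(p) ∧ ¬surj(p)` of the cell's
class X9 (here with CM curves included). `→` is restriction; `←`: at a surjective pair (im) holds
(`X9.bigIm_of_surj`, `p ≥ 5`) and BCS applies; at a non-surjective one the hypothesis does. With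
`X9.bigIm_iff_surj_of_irr` this is Rem. 1.1.3 (iii) ("the essential case excluded by Theorem 1.1.2 is
that of (residually) dihedral primes") as a kernel statement about the column.
[cite: BurungaleCastellaSkinner2025, Thm. 1.1.2 (b), Rem. 1.1.3 (iii)] [cite: Serre1972, §2.4 Prop. 15; IV §3.4] -/
theorem forall_mazurMainConjecture_irreducible_iff_nonSurj
    (hBCS : thm112b_charIdeal_eq_padicLFunction_integral) :
    (∀ (W : WeierstrassCurve ℚ) [W.IsElliptic] [W.IsGloballyMinimal] (p : ℕ) [Fact p.Prime],
        3 < p → GoodOrd W p → Irr W p → MazurMainConjecture W p) ↔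
      (∀ (W : WeierstrassCurve ℚ) [W.IsElliptic] [W.IsGloballyMinimal] (p : ℕ) [Fact p.Prime],
        3 < p → GoodOrd W p → Irr W p → ¬ Surj W p → MazurMainConjecture W p) := by
  constructor
  · intro h W _ _ p _ hp hord hirr _
    exact h W p hp hord hirr
  · intro h W _ _ p _ hp hord hirr
    by_cases hs : Surj W p
    · have hp5 : 5 ≤ p :=
        (Fact.out : p.Prime).five_le_of_ne_two_of_ne_three (by omega) (by omega)
      exact mazurMainConjecture_of_bcsThm112b_of_surj hBCS hp5 hord hs
    · exact h W p hp hord hirr hs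

section Curve

variable {W : WeierstrassCurve ℚ} [W.IsElliptic] [W.IsGloballyMinimal] {p : ℕ} [Fact p.Prime]

/-! ### §2. Row C2 ∩ {r = 0}: BCS Cor. 1.3.1 (r = 0) re-assembled — no `@[conjecture]` binder left -/

/-- **Rank `0` on BCS's locus** (`p > 3` good ordinary, (irr), (im); no CM / conductor condition):
Thm. 1.1.2 (b) (`hBCS`) + Greenberg 1999 Thm. 4.1 (`hGr`) + modularity (`hmod`) + GZK (`hGZK`) ⇒
`BSD(E,p)`, through the universal skeleton `bsdp_of_mazurMainConjecture_of_analyticRank_eq_zero`. This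
is the printed proof of Cor. 1.3.1, case `r = 0` ("the equality of characteristic ideals in Theorem
1.1.2, the interpolation property of `L_p(E/ℚ)` at the trivial character, and … [Gre99, Thm. 4.1]",
p. 4), every step a kernel object. [cite: BurungaleCastellaSkinner2025, Cor. 1.3.1 (r = 0) and its proof (p. 4)]
[cite: GreenbergLNM1716, Thm. 4.1 (p. 102)] [cite: Miller2011LMS, Def. 1.1] -/
theorem bsdp_rankZero_of_bcsThm112b (hBCS : thm112b_charIdeal_eq_padicLFunction_integral)
    (hGr : greenberg_charValue_rankZero) (hmod : nonempty_modularParametrizationData)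
    (hGZK : rank_eq_analyticRank_of_analyticRank_le_one) (hp : 3 < p) (hord : GoodOrd W p)
    (hirr : Irr W p) (him : BigIm W p) (hr0 : W.analyticRank = 0) : BSDp W p :=
  bsdp_of_mazurMainConjecture_of_analyticRank_eq_zero hGr hmod hGZK (by omega) hord hr0
    (mazurMainConjecture_of_bcsThm112b hBCS hp hord hirr him)

/-- **C2 ∩ {r = 0} at main-conjecture level, the main conjecture now a PUBLISHED fact**: feeds gen-0's
`RowC2.bsdp_rankZero_of_mazurMainConjecture` with `RowC2.mazurMainConjecture_of_bcsThm112b`. Compare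
`RowC2.bsdp` (Partition/Bsdp), which takes Cor. 1.3.1 itself as the named fact.
[cite: BurungaleCastellaSkinner2025, Cor. 1.3.1 (r = 0), Thm. 1.1.2 (b)] [cite: GreenbergLNM1716, Thm. 4.1 (p. 102)] -/
theorem RowC2.bsdp_rankZero_of_bcsThm112b (hBCS : thm112b_charIdeal_eq_padicLFunction_integral)
    (hGr : greenberg_charValue_rankZero) (hmod : nonempty_modularParametrizationData)
    (hGZK : rank_eq_analyticRank_of_analyticRank_le_one) (h : RowC2 W p) (hr0 : W.analyticRank = 0) :
    BSDp W p :=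
  RowC2.bsdp_rankZero_of_mazurMainConjecture hGr hmod hGZK h hr0
    (RowC2.mazurMainConjecture_of_bcsThm112b hBCS h)

end Curve

/-! ### §3. Rank one at a Heegner datum: STEP L + Kolyvagin + Gross–Zagier + the twist's typed cyclotomic main conjecture -/

/-- **Rank one at a good ordinary ODD `p`, at a Heegner datum: STEP L + Kolyvagin + Gross–Zagier +
the CYCLOTOMIC MAIN CONJECTURE OF THE TWIST (as the tree types it: `MazurMainConjecture Wd p`) +
Greenberg's control theorem ⇒ `BSD(E,p)`** — the main-conjecture-level form of gen-0's
`X11b.bsdp_rankOne_of_indexLowerBoundAt_of_goodOrd_twist` (which fed the twist's rank-`0` `p`-part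
from Skinner–Urban and so needed a (ram) prime): here the twist's rank-`0` `p`-part is DERIVED from
its typed main conjecture `hMCd` by `padicValRat_bsd_rank_zero_of_mazurMainConjecture` (Greenberg
1999 Thm. 4.1 `hGr` + Mazur–Swinnerton-Dyer interpolation; Néron-normalised, so no period-unit fact
is needed), and `hMCd` is in turn a PUBLISHED fact on {(irr), (im)}: BCS 2025 Thm. 1.1.2 (b) for
`p > 3` (`…_of_bcs` below), Yan–Zhu 2026 Thm. 4.9 for `p = 3` (companion file). Data: `K` imaginary
quadratic with the Heegner hypothesis for the level `N` and `L(E^{d_K},1) ≠ 0`, `P` the Heegner point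
of a parametrisation datum `Dt` with `p ∤ c(Dt)`, `p ∤ #𝓞_K^×`, a globally minimal model
`Wd = Cd • E^{(d_K)}` good ordinary at `p` (`hordd`) with the two decidable side conditions (`htam`,
`hu`). The pair: `ord_{s=1} L(E,s) = 1`, `p ≥ 3`, `ρ̄_{E,p}` surjective (Kolyvagin's bound `hB`),
`p ∤ ∏_ℓ c_ℓ(E)`. PUBLISHED inputs by name: Gross–Zagier (`hGZ`), Kolyvagin 1990 (`hKo`, `hB`),
Greenberg Thm. 4.1 (`hGr`), GZK (`hGZK`), modularity (`hmod`, `hpar`). TYPED inputs: STEP L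
`IndexLowerBoundAt W p K P` (`hL`) and `MazurMainConjecture Wd p` (`hMCd`). Chain: STEP L + Kolyvagin
⇒ identity over `K` (`indexIdentityAt_of_lowerBound_of_kolyvagin`) ⇒ descent
(`bsdp_of_indexIdentityAt`), "the `r = 0` result for the `K`-quadratic twist of `E`" (BCS Cor. 1.3.1,
proof) being the last input of that descent. [cite: BurungaleCastellaSkinner2025, Cor. 1.3.1 (r = 1), proof (p. 4)]
[cite: JetchevSkinnerWan2017, §7.4.1 (pp. 30–31)] [cite: GreenbergLNM1716, Thm. 4.1 (p. 102)]
[cite: McCallumLMS1991, §1 Theorem (Kolyvagin), p. 296] [cite: GrossZagier1986, I (6.5) and V (2.1)]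
[cite: Miller2011LMS, Def. 1.1] -/
theorem X11b.bsdp_rankOne_of_indexLowerBoundAt_of_twist_mazurMainConjecture
    (W : WeierstrassCurve ℚ) [W.IsElliptic] [W.IsGloballyMinimal] (p : ℕ) [Fact p.Prime]
    (N : ℕ) [NeZero N] (K : Type) [Field K] [NumberField K]
    (Dt : ModularParametrizationData W N) (H : HeegnerDatum N (NumberField.discr K)) (ι : K →+* ℂ)
    (P : (W.baseChange K).toAffine.Point)
    -- the published inputs (named facts of the tree)
    (hGZ : gross_zagier N W K) (hKo : kolyvagin N W K)
    (hB : Kolyvagin1990_padicValNat_card_sha_le N W K) (hGr : greenberg_charValue_rankZero)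
    (hGZK : rank_eq_analyticRank_of_analyticRank_le_one) (hmod : hasEntireLFunction_rat)
    (hpar : nonempty_modularParametrizationData)
    -- the pair
    (hr : W.analyticRank = 1) (hp3 : 3 ≤ p) (hsurj : Surj W p) (htam0 : ¬ p ∣ W.tamagawaProduct)
    -- the Heegner data
    (hK : IsImaginaryQuadratic K) (hHN : SatisfiesHeegnerHypothesis N K)
    (hP : WeierstrassCurve.Affine.Point.map ι.toRatAlgHom P = heegnerPointComplex Dt H)
    (hc : ¬ (p : ℤ) ∣ Dt.c) (hμ : ¬ p ∣ Units.torsionOrder K)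
    (hLt : (W.quadraticTwist (NumberField.discr K : ℚ)).entireLFunction 1 ≠ 0)
    -- a globally minimal model of the twist, good ordinary at `p`, the side conditions
    (Wd : WeierstrassCurve ℚ) [Wd.IsElliptic] [Wd.IsGloballyMinimal] (Cd : VariableChange ℚ)
    (hWd : Cd • W.quadraticTwist (NumberField.discr K : ℚ) = Wd) (hordd : GoodOrd Wd p)
    (htam : padicValNat p Wd.tamagawaProduct = padicValNat p W.tamagawaProduct)
    (hu : padicValRat p (Cd.u : ℚ) = 0)
    -- the typed inputs: the twist's cyclotomic main conjecture and STEP L at the datum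
    (hMCd : MazurMainConjecture Wd p) (hL : IndexLowerBoundAt W p K P) : BSDp W p := by
  have hp2 : p ≠ 2 := by omega
  have hD0 : (NumberField.discr K : ℚ) ≠ 0 := by exact_mod_cast NumberField.discr_ne_zero K
  haveI hEt : (W.quadraticTwist (NumberField.discr K : ℚ)).IsElliptic :=
    W.isElliptic_quadraticTwist hD0
  -- the Heegner point has infinite order (Gross–Zagier, `L'(E,1) ≠ 0`, `L(E^D,1) ≠ 0`)
  have hL0 : W.entireLFunction 1 = 0 := entireLFunction_one_eq_zero_of_analyticRank_eq_one hr
  obtain ⟨-, hderiv⟩ := leadingLCoeff_eq_deriv_of_analyticRank_eq_one hr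
  have hLK : LDerivEK W K ≠ 0 := by
    rw [lDerivEK_eq_deriv_mul W K hmod hL0]; exact mul_ne_zero hderiv hLt
  have hPH : IsHeegnerPoint N W K P := ⟨Dt, H, ι, hP⟩
  have hPinf : ¬ IsOfFinAddOrder P :=
    (lDerivEK_ne_zero_iff_not_isOfFinAddOrder W N K hGZ hK hHN hPH).mp hLK
  -- STEP L + STEP U ⇒ the identity over `K`
  have hid : Finite (W.baseChange K).sha → IndexIdentityAt W p K P := fun _ =>
    indexIdentityAt_of_lowerBound_of_kolyvagin W p hB hK hHN hPH hPinf hp2 hsurj htam0 hL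
  -- the twist: analytic rank `0`, finiteness, and its rank-`0` `p`-part FROM ITS MAIN CONJECTURE
  have hLt' : (W.quadraticTwist (NumberField.discr K : ℚ)).entireLFunction = Wd.entireLFunction := by
    rw [← hWd, entireLFunction_smul]
  have hLd1 : Wd.entireLFunction 1 ≠ 0 := by rw [← hLt']; exact hLt
  have hfinSd : Finite Wd.sha := (hGZK Wd (by
    rw [(Wd.analyticRank_eq_zero_iff_holds (hmod Wd)).2 hLd1]; exact zero_le_one)).2
  have htw := padicValRat_bsd_rank_zero_of_mazurMainConjecture Wd p hordd.1 hordd.2 hLd1 hfinSd hpar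
    (fun κ γ hκ hγ hγ' D _ hX fE hfE hSel ↦
      hGr Wd p hp2 hordd.1 hordd.2 κ γ hκ hγ hγ' D hX fE hfE hSel) hMCd
  exact bsdp_of_indexIdentityAt W p N K Dt H ι P hGZ hKo hGZK hmod hK hHN hP hp2 hc hμ hr hLt Wd Cd
    hWd htw htam hu hid

/-- **The BCS instance at the datum** (`p ≥ 5`, (irr) + (im) for `E` and for the twist model): the
twist's typed main conjecture is BCS 2025 Thm. 1.1.2 (b) (`hBCS`), and `ρ̄_{E,p}` is surjective by
(irr) + (im) (`surj_of_irr_of_bigIm`, Serre Prop. 15). [cite: BurungaleCastellaSkinner2025, Cor. 1.3.1 (r = 1), proof (p. 4); Thm. 1.1.2 (b)] -/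
theorem X11b.bsdp_rankOne_of_indexLowerBoundAt_of_goodOrd_twist_of_bcs
    (W : WeierstrassCurve ℚ) [W.IsElliptic] [W.IsGloballyMinimal] (p : ℕ) [Fact p.Prime]
    (N : ℕ) [NeZero N] (K : Type) [Field K] [NumberField K]
    (Dt : ModularParametrizationData W N) (H : HeegnerDatum N (NumberField.discr K)) (ι : K →+* ℂ)
    (P : (W.baseChange K).toAffine.Point)
    (hGZ : gross_zagier N W K) (hKo : kolyvagin N W K)
    (hB : Kolyvagin1990_padicValNat_card_sha_le N W K)
    (hBCS : thm112b_charIdeal_eq_padicLFunction_integral) (hGr : greenberg_charValue_rankZero)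
    (hGZK : rank_eq_analyticRank_of_analyticRank_le_one) (hmod : hasEntireLFunction_rat)
    (hpar : nonempty_modularParametrizationData)
    (hr : W.analyticRank = 1) (hp5 : 5 ≤ p) (hirr : Irr W p) (him : BigIm W p)
    (htam0 : ¬ p ∣ W.tamagawaProduct)
    (hK : IsImaginaryQuadratic K) (hHN : SatisfiesHeegnerHypothesis N K)
    (hP : WeierstrassCurve.Affine.Point.map ι.toRatAlgHom P = heegnerPointComplex Dt H)
    (hc : ¬ (p : ℤ) ∣ Dt.c) (hμ : ¬ p ∣ Units.torsionOrder K)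
    (hLt : (W.quadraticTwist (NumberField.discr K : ℚ)).entireLFunction 1 ≠ 0)
    (Wd : WeierstrassCurve ℚ) [Wd.IsElliptic] [Wd.IsGloballyMinimal] (Cd : VariableChange ℚ)
    (hWd : Cd • W.quadraticTwist (NumberField.discr K : ℚ) = Wd)
    (hordd : GoodOrd Wd p) (hirrd : Irr Wd p) (himd : BigIm Wd p)
    (htam : padicValNat p Wd.tamagawaProduct = padicValNat p W.tamagawaProduct)
    (hu : padicValRat p (Cd.u : ℚ) = 0)
    (hL : IndexLowerBoundAt W p K P) : BSDp W p :=
  X11b.bsdp_rankOne_of_indexLowerBoundAt_of_twist_mazurMainConjecture W p N K Dt H ι P hGZ hKo hB hGr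
    hGZK hmod hpar hr (by omega) (surj_of_irr_of_bigIm W p hirr him) htam0 hK hHN hP hc hμ hLt Wd Cd
    hWd hordd htam hu (hBCS Wd p (by omega) hordd hirrd himd) hL

end Summit.BirchSwinnertonDyer.Rank1Residual

end
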